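import Literature.Computability.QuantumComplexity.ADHPathModel
import Literature.Computability.Cryptography.QuantumCircuitDescFP
import Literature.Computability.Complexity.PlumbingBricks
import Literature.Computability.Complexity.FPStringBricks
import Literature.Computability.Complexity.LengthCompare
import Literature.Computability.Complexity.StringEquality
import HarnessLib

/-!
# The Adleman–DeMarrais–Huang path-pair machine as an `FP` string function

Machine half of the proof of `Literature.Computability.QuantumComplexity.BQP_subset_PP`
(Adleman–DeMarrais–Huang 1997, Thm. 6.4 / Lemma 6.10: `BQP ⊆ PP`), continuing
`ADHPathModel.lean` (total path semantics `tStep`/`tRun`). The nondeterministic machine `M'` of the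
printed proof (p. 1538: "use `P₁` to choose a path … compute the configuration `C₁` … similarly use
`P₂` …; trivial guesses answer yes/no according to `E`; nontrivial guesses answer according to the
sign and to whether `C₁` accepts") becomes, for the tree's `PP = P·P` (Gill: strict majority over
coin strings of polynomial length), a deterministic polynomial-time predicate of the input `x` and
the guess string `y = b b' c …`. This file writes that predicate in the brick algebra of
`BrickAlgebra.lean` / `PlumbingBricks.lean` / `FPStringBricks.lean` (no machine is programmed: every
step is a composition of `FP` string functions already in the tree, as in `ShorRoundFP.lean`):

* the **walk record** `rec6 d E co w ph v` — description `d` (kept; it clocks the loop), the codes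
  `E` of the gates still ahead (`encList`), the unread coins `co`, the current label `w` (one bit
  per wire, wire `0` first), the phase `ph = 1^φ` (`φ < 8`) and the validity flag `v`;
* `roundF` — **one gate**: split the next gate code `0 ⟨bin op, ⟨1ᵏ, ⟨bin i, ⟨bin j, ε⟩⟩⟩⟩`
  (`QGate.encode`) off `E`, read the choice bit off `co`, convert the wire numbers to unary
  (`binToUnaryFn`), read the addressed bits (`bitAtFn`), rewrite the label (`takeFn`/`dropFn`/
  `concatFn`) and the phase (`modLenFn` modulo `1⁸`), exactly as `ADH.tStep`
  (`roundF_rec`); it keeps the first field and lengthens no string by more than a constant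
  (`fstF_roundF`, `length_roundF_le`), so `passF = roundF^{|d|}` is in `FP`
  (`iterate_mem_FP_of_growth`) and computes `ADH.tRun` (`iterate_roundF`, `pass1F_boolPair`,
  `twoF_boolPair`);
* `adhFn F` — **the whole predicate** on `⟨x, y⟩`: lay out the record from the description
  `descFn F x` of the `|x|`-th circuit (`QuantumCircuitDescFP.lean`) and the padded input, walk the
  first path, walk the second path on the remaining coins, and answer with the threshold tree
  `verdictF` on three more coins (`verdictF_apply`, `vtree_eq_threshold`: "yes" iff
  `⟦c⟧ < 4 + wt`); `adhFn_mem_FP`,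
  `oneBit_adhFn`, and **`adhFn_boolPair`**: its value is `[threshold (4 + wtPair …) c]`.

## References

* L. M. Adleman, J. DeMarrais, M.-D. A. Huang, *Quantum computability*, SIAM J. Comput. 26
  (1997) 1524–1540, §6, Lemma 6.10 and its proof (pp. 1538–1539), steps 1–5 of the machine `M'`.
* S. Arora, B. Barak, *Computational Complexity: A Modern Approach*, CUP 2009, §1.3 (polynomial
  time is closed under composition and bounded loops), §6.2 (descriptions of uniform families).
-/

noncomputable section

namespace Literature.Computability.QuantumComplexity

namespace ADH

open _root_.Computability Polynomial Complexity Complexity.Brick Complexity.Plumb Cryptography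

attribute [-simp] Brick.nthF_zero Brick.sndPow_zero

/-! ### Generic plumbing: conditions with a Boolean model -/

/-- Pairing two field functions. [folklore] -/
abbrev pr (f g : List Bool → List Bool) : List Bool → List Bool := fanoutFn f g

/-- The test "`f z` is the fixed string `w`", as a one-bit string function. [folklore] -/
def eqC (w : List Bool) (f : List Bool → List Bool) : List Bool → List Bool :=
  eqPairFn ∘ pr f (fun _ => w)

/-- Value of `eqC`. [folklore] -/
@[simp] theorem eqC_apply (w : List Bool) (f : List Bool → List Bool) (z : List Bool) :
    eqC w f z = [decide (f z = w)] := by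
  simp [eqC, eqPairFn_boolPair]

/-- `eqC w f ∈ FP` for `f ∈ FP`. [folklore] -/
theorem eqC_mem_FP (w : List Bool) {f : List Bool → List Bool} (hf : f ∈ FP) : eqC w f ∈ FP :=
  comp_mem_FP eqPairFn_mem_FP (fanoutFn_mem_FP hf (const_mem_FP _))

/-- The test "the first bit of `f z` is `1`" (`ADH.headBit`), as a one-bit string function.
[folklore] -/
def bitT (f : List Bool → List Bool) : List Bool → List Bool := eqC [true] (take1Fn ∘ f)

/-- Value of `bitT`. [folklore] -/
@[simp] theorem bitT_apply (f : List Bool → List Bool) (z : List Bool) : bitT f z = [headBit (f z)] := by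
  simp [bitT, headBit, take1Fn]

/-- `bitT f ∈ FP` for `f ∈ FP`. [folklore] -/
theorem bitT_mem_FP {f : List Bool → List Bool} (hf : f ∈ FP) : bitT f ∈ FP :=
  eqC_mem_FP _ (comp_mem_FP take1Fn_mem_FP hf)

/-- The emptiness test of a field, as a one-bit string function. [folklore] -/
def nilT (f : List Bool → List Bool) : List Bool → List Bool := isNilFn ∘ f

/-- Value of `nilT`. [folklore] -/
@[simp] theorem nilT_apply (f : List Bool → List Bool) (z : List Bool) :
    nilT f z = [decide (f z = [])] := rfl

/-- `nilT f ∈ FP` for `f ∈ FP`. [folklore] -/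
theorem nilT_mem_FP {f : List Bool → List Bool} (hf : f ∈ FP) : nilT f ∈ FP :=
  comp_mem_FP isNilFn_mem_FP hf

/-! ### The walk record -/

/-- The six-field walk record `⟨d, ⟨E, ⟨co, ⟨w, ⟨ph, v⟩⟩⟩⟩⟩`. [folklore] -/
def rec6 (d E co w ph v : List Bool) : List Bool :=
  boolPair d (boolPair E (boolPair co (boolPair w (boolPair ph v))))

attribute [simp] rec6

/-- Field `d` (the description; kept). [folklore] -/
abbrev dF : List Bool → List Bool := nthF 0
/-- Field `E` (codes of the gates ahead). [folklore] -/
abbrev eF : List Bool → List Bool := nthF 1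
/-- Field `co` (unread coins). [folklore] -/
abbrev coF : List Bool → List Bool := nthF 2
/-- Field `w` (current label). [folklore] -/
abbrev wF : List Bool → List Bool := nthF 3
/-- Field `ph` (phase, unary modulo `8`). [folklore] -/
abbrev phF : List Bool → List Bool := nthF 4
/-- Field `v` (validity flag). [folklore] -/
abbrev vF : List Bool → List Bool := sndPow 4

/-- Assembling a record from six field functions. [folklore] -/
def mk6 (a b c d e f : List Bool → List Bool) : List Bool → List Bool :=
  pr a (pr b (pr c (pr d (pr e f))))

/-- `mk6` applied. [folklore] -/
@[simp] theorem mk6_apply (a b c d e f : List Bool → List Bool) (z : List Bool) :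
    mk6 a b c d e f z = rec6 (a z) (b z) (c z) (d z) (e z) (f z) := by
  simp [mk6]

/-- `mk6` of `FP` functions is in `FP`. [folklore] -/
theorem mk6_mem_FP {a b c d e f : List Bool → List Bool} (ha : a ∈ FP) (hb : b ∈ FP) (hc : c ∈ FP)
    (hd : d ∈ FP) (he : e ∈ FP) (hf : f ∈ FP) : mk6 a b c d e f ∈ FP :=
  fanoutFn_mem_FP ha (fanoutFn_mem_FP hb (fanoutFn_mem_FP hc (fanoutFn_mem_FP hd (fanoutFn_mem_FP he hf))))

/-- The fields of a record together are not longer than the record: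
`2(|d| + |E| + |co| + |w| + |ph|) + |v| ≤ |z|`, on every string. [folklore] -/
theorem length_fields_le (z : List Bool) :
    2 * ((dF z).length + (eF z).length + (coF z).length + (wF z).length + (phF z).length) +
      (vF z).length ≤ z.length := by
  have h0 : 2 * (nthF 1 z).length + (sndPow 1 z).length ≤ (sndPow 0 z).length :=
    length_nthF_succ_add_sndPow_succ_le 0 z
  have h1 : 2 * (nthF 2 z).length + (sndPow 2 z).length ≤ (sndPow 1 z).length :=
    length_nthF_succ_add_sndPow_succ_le 1 z
  have h2 : 2 * (nthF 3 z).length + (sndPow 3 z).length ≤ (sndPow 2 z).length :=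
    length_nthF_succ_add_sndPow_succ_le 2 z
  have h3 : 2 * (nthF 4 z).length + (sndPow 4 z).length ≤ (sndPow 3 z).length :=
    length_nthF_succ_add_sndPow_succ_le 3 z
  have h : 2 * (nthF 0 z).length + (sndPow 0 z).length ≤ z.length := by
    simpa [Brick.nthF_zero, Brick.sndPow_zero] using length_fstF_sndF_le z
  show 2 * ((nthF 0 z).length + (nthF 1 z).length + (nthF 2 z).length + (nthF 3 z).length +
    (nthF 4 z).length) + (sndPow 4 z).length ≤ z.length
  omega

/-! ### The data of one gate -/

/-- The code of the next gate: `E = ⟨g, E'⟩`. [folklore] -/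
def gF : List Bool → List Bool := fstF ∘ eF
/-- The codes of the gates after it. [folklore] -/
def e'F : List Bool → List Bool := sndF ∘ eF
/-- The choice bit (first unread coin, `0` if none). [folklore] -/
def cT : List Bool → List Bool := bitT coF
/-- The coins after it. [folklore] -/
def co'F : List Bool → List Bool := List.tail ∘ coF
/-- The gate code without its tag bit: `⟨bin op, wires⟩`. [folklore] -/
def gtF : List Bool → List Bool := List.tail ∘ gF
/-- The binary code of the gate symbol (`ε, 1, 01, 11` for `H, S, T, CNOT`). [folklore] -/
def opF : List Bool → List Bool := fstF ∘ gtF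
/-- The wire numbers `⟨bin i, ⟨bin j, ε⟩⟩` (the unary arity skipped). [folklore] -/
def wsF : List Bool → List Bool := sndF ∘ sndF ∘ gtF
/-- The first wire number, binary. [folklore] -/
def iF : List Bool → List Bool := fstF ∘ wsF
/-- The second wire number, binary (junk for one-qubit gates). [folklore] -/
def jF : List Bool → List Bool := fstF ∘ sndF ∘ wsF
/-- The first wire number in unary, capped by the label length. [folklore] -/
def uiF : List Bool → List Bool := binToUnaryFn ∘ pr wF iF
/-- The second wire number in unary, capped by the label length. [folklore] -/
def ujF : List Bool → List Bool := binToUnaryFn ∘ pr wF jF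
/-- The label bit on the first wire. [folklore] -/
def wiT : List Bool → List Bool := bitT (bitAtFn ∘ pr uiF wF)
/-- The label bit on the second wire. [folklore] -/
def wjT : List Bool → List Bool := bitT (bitAtFn ∘ pr ujF wF)

/-- Writing the bit `b z` at the unary position `|u z|` of the label:
`w ↾ |u| ++ b ++ w ⇂ (|u| + 1)`. [folklore] -/
def setF (u b : List Bool → List Bool) : List Bool → List Bool :=
  OracleCompose.concatFn ∘ pr (takeFn ∘ pr u wF)
    (OracleCompose.concatFn ∘ pr b (dropFn ∘ pr (List.cons true ∘ u) wF))

/-- Adding `k` to the phase and reducing modulo `8`: `1^{(|ph| + k) mod 8}`. [folklore] -/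
def addPh (k : ℕ) : List Bool → List Bool :=
  modLenFn ∘ pr (fun _ => ones 8) (OracleCompose.concatFn ∘ pr phF (fun _ => ones k))

/-- The exclusive or of two one-bit conditions. [folklore] -/
def xorT (a b : List Bool → List Bool) : List Bool → List Bool := iteFn a (notFn b) b

/-- The flag normalised to one bit. [folklore] -/
def vT : List Bool → List Bool := eqC [true] vF
/-- The flag after a non-branching gate: cleared by a choice bit `1`. [folklore] -/
def v'T : List Bool → List Bool := andFn vT (notFn cT)

/-- The record after an `H` gate. [cite: AdlemanDeMarraisHuang1997, §6 Lemma 6.10 (proof, step 3)] -/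
def hR : List Bool → List Bool :=
  mk6 dF e'F co'F (setF uiF cT) (iteFn (andFn wiT cT) (addPh 4) (addPh 0)) vT
/-- The record after an `S` gate. [cite: AdlemanDeMarraisHuang1997, §6 Lemma 6.10 (proof, step 3)] -/
def sR : List Bool → List Bool :=
  mk6 dF e'F co'F wF (iteFn wiT (addPh 2) (addPh 0)) v'T
/-- The record after a `T` gate. [cite: AdlemanDeMarraisHuang1997, §6 Lemma 6.10 (proof, step 3)] -/
def tR : List Bool → List Bool :=
  mk6 dF e'F co'F wF (iteFn wiT (addPh 1) (addPh 0)) v'T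
/-- The record after a `CNOT` gate. [cite: AdlemanDeMarraisHuang1997, §6 Lemma 6.10 (proof, step 3)] -/
def cR : List Bool → List Bool :=
  mk6 dF e'F co'F (setF ujF (xorT wjT wiT)) (addPh 0) v'T
/-- The record re-assembled unchanged (no gate ahead). [folklore] -/
def idleR : List Bool → List Bool := mk6 dF eF coF wF phF vF

/-- **One round of the walk**: idle if no gate is ahead, otherwise dispatch on the gate symbol.
[cite: AdlemanDeMarraisHuang1997, §6 Lemma 6.10 (proof, step 3: "use P₁ to choose a path of length t for M on input x. Compute the configuration C₁ which results along this path")] -/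
def roundF : List Bool → List Bool :=
  iteFn (nilT eF) idleR (iteFn (nilT opF) hR (iteFn (eqC [true] opF) sR (iteFn (eqC [false, true] opF) tR cR)))

/-! ### Membership in `FP` -/

/-- `gF` is in `FP` (composition of bricks). [folklore] -/
theorem gF_mem_FP : gF ∈ FP := comp_mem_FP fstF_mem_FP (nthF_mem_FP 1)
/-- `e'F` is in `FP` (composition of bricks). [folklore] -/
theorem e'F_mem_FP : e'F ∈ FP := comp_mem_FP sndF_mem_FP (nthF_mem_FP 1)
/-- `cT` is in `FP` (composition of bricks). [folklore] -/
theorem cT_mem_FP : cT ∈ FP := bitT_mem_FP (nthF_mem_FP 2)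
/-- `co'F` is in `FP` (composition of bricks). [folklore] -/
theorem co'F_mem_FP : co'F ∈ FP := comp_mem_FP PRelSigma.tail_mem_FP (nthF_mem_FP 2)
/-- `gtF` is in `FP` (composition of bricks). [folklore] -/
theorem gtF_mem_FP : gtF ∈ FP := comp_mem_FP PRelSigma.tail_mem_FP gF_mem_FP
/-- `opF` is in `FP` (composition of bricks). [folklore] -/
theorem opF_mem_FP : opF ∈ FP := comp_mem_FP fstF_mem_FP gtF_mem_FP
/-- `wsF` is in `FP` (composition of bricks). [folklore] -/
theorem wsF_mem_FP : wsF ∈ FP := comp_mem_FP sndF_mem_FP (comp_mem_FP sndF_mem_FP gtF_mem_FP)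
/-- `iF` is in `FP` (composition of bricks). [folklore] -/
theorem iF_mem_FP : iF ∈ FP := comp_mem_FP fstF_mem_FP wsF_mem_FP
/-- `jF` is in `FP` (composition of bricks). [folklore] -/
theorem jF_mem_FP : jF ∈ FP := comp_mem_FP fstF_mem_FP (comp_mem_FP sndF_mem_FP wsF_mem_FP)
/-- `uiF` is in `FP` (composition of bricks). [folklore] -/
theorem uiF_mem_FP : uiF ∈ FP := comp_mem_FP binToUnaryFn_mem_FP (fanoutFn_mem_FP (nthF_mem_FP 3) iF_mem_FP)
/-- `ujF` is in `FP` (composition of bricks). [folklore] -/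
theorem ujF_mem_FP : ujF ∈ FP := comp_mem_FP binToUnaryFn_mem_FP (fanoutFn_mem_FP (nthF_mem_FP 3) jF_mem_FP)
/-- `wiT` is in `FP` (composition of bricks). [folklore] -/
theorem wiT_mem_FP : wiT ∈ FP := bitT_mem_FP (comp_mem_FP bitAtFn_mem_FP (fanoutFn_mem_FP uiF_mem_FP (nthF_mem_FP 3)))
/-- `wjT` is in `FP` (composition of bricks). [folklore] -/
theorem wjT_mem_FP : wjT ∈ FP := bitT_mem_FP (comp_mem_FP bitAtFn_mem_FP (fanoutFn_mem_FP ujF_mem_FP (nthF_mem_FP 3)))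
/-- `setF` is in `FP` (composition of bricks). [folklore] -/
theorem setF_mem_FP {u b : List Bool → List Bool} (hu : u ∈ FP) (hb : b ∈ FP) : setF u b ∈ FP :=
  comp_mem_FP OracleCompose.concatFn_mem_FP (fanoutFn_mem_FP
    (comp_mem_FP takeFn_mem_FP (fanoutFn_mem_FP hu (nthF_mem_FP 3)))
    (comp_mem_FP OracleCompose.concatFn_mem_FP (fanoutFn_mem_FP hb
      (comp_mem_FP dropFn_mem_FP (fanoutFn_mem_FP (comp_mem_FP (cons_mem_FP true) hu) (nthF_mem_FP 3))))))
/-- `addPh` is in `FP` (composition of bricks). [folklore] -/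
theorem addPh_mem_FP (k : ℕ) : addPh k ∈ FP :=
  comp_mem_FP modLenFn_mem_FP (fanoutFn_mem_FP (const_mem_FP _)
    (comp_mem_FP OracleCompose.concatFn_mem_FP (fanoutFn_mem_FP (nthF_mem_FP 4) (const_mem_FP _))))
/-- `xorT` is in `FP` (composition of bricks). [folklore] -/
theorem xorT_mem_FP {a b : List Bool → List Bool} (ha : a ∈ FP) (hb : b ∈ FP) : xorT a b ∈ FP :=
  iteFn_mem_FP ha (notFn_mem_FP hb) hb
/-- `vT` is in `FP` (composition of bricks). [folklore] -/
theorem vT_mem_FP : vT ∈ FP := eqC_mem_FP _ (sndPow_mem_FP 4)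
/-- `v'T` is in `FP` (composition of bricks). [folklore] -/
theorem v'T_mem_FP : v'T ∈ FP := andFn_mem_FP vT_mem_FP (notFn_mem_FP cT_mem_FP)
/-- `hR` is in `FP` (composition of bricks). [folklore] -/
theorem hR_mem_FP : hR ∈ FP :=
  mk6_mem_FP (nthF_mem_FP 0) e'F_mem_FP co'F_mem_FP (setF_mem_FP uiF_mem_FP cT_mem_FP)
    (iteFn_mem_FP (andFn_mem_FP wiT_mem_FP cT_mem_FP) (addPh_mem_FP 4) (addPh_mem_FP 0)) vT_mem_FP
/-- `sR` is in `FP` (composition of bricks). [folklore] -/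
theorem sR_mem_FP : sR ∈ FP :=
  mk6_mem_FP (nthF_mem_FP 0) e'F_mem_FP co'F_mem_FP (nthF_mem_FP 3)
    (iteFn_mem_FP wiT_mem_FP (addPh_mem_FP 2) (addPh_mem_FP 0)) v'T_mem_FP
/-- `tR` is in `FP` (composition of bricks). [folklore] -/
theorem tR_mem_FP : tR ∈ FP :=
  mk6_mem_FP (nthF_mem_FP 0) e'F_mem_FP co'F_mem_FP (nthF_mem_FP 3)
    (iteFn_mem_FP wiT_mem_FP (addPh_mem_FP 1) (addPh_mem_FP 0)) v'T_mem_FP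
/-- `cR` is in `FP` (composition of bricks). [folklore] -/
theorem cR_mem_FP : cR ∈ FP :=
  mk6_mem_FP (nthF_mem_FP 0) e'F_mem_FP co'F_mem_FP (setF_mem_FP ujF_mem_FP (xorT_mem_FP wjT_mem_FP wiT_mem_FP))
    (addPh_mem_FP 0) v'T_mem_FP
/-- `idleR` is in `FP` (composition of bricks). [folklore] -/
theorem idleR_mem_FP : idleR ∈ FP :=
  mk6_mem_FP (nthF_mem_FP 0) (nthF_mem_FP 1) (nthF_mem_FP 2) (nthF_mem_FP 3) (nthF_mem_FP 4) (sndPow_mem_FP 4)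

/-- **`roundF ∈ FP`.** [cite: AroraBarak2009, §1.3] -/
theorem roundF_mem_FP : roundF ∈ FP :=
  iteFn_mem_FP (nilT_mem_FP (nthF_mem_FP 1)) idleR_mem_FP (iteFn_mem_FP (nilT_mem_FP opF_mem_FP) hR_mem_FP
    (iteFn_mem_FP (eqC_mem_FP _ opF_mem_FP) sR_mem_FP (iteFn_mem_FP (eqC_mem_FP _ opF_mem_FP) tR_mem_FP cR_mem_FP)))

/-! ### Values of the pieces on every string -/

/-- Value of a written label. [folklore] -/
theorem setF_apply (u b : List Bool → List Bool) (z : List Bool) :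
    setF u b z = (wF z).take (u z).length ++ b z ++ (wF z).drop ((u z).length + 1) := by
  simp [setF, List.append_assoc]

/-- Value of an updated phase. [folklore] -/
theorem addPh_apply (k : ℕ) (z : List Bool) : addPh k z = ones (((phF z).length + k) % 8) := by
  simp [addPh]

/-- Value of `xorT` on Boolean-modelled conditions. [folklore] -/
theorem xorT_apply {a b : List Bool → List Bool} {z : List Bool} {x y : Bool} (ha : a z = [x]) (hb : b z = [y]) :
    xorT a b z = [x ^^ y] := by
  rw [xorT, iteFn_apply ha]
  cases x
  · simp [hb]
  · rw [if_pos rfl, notFn_apply hb]; cases y <;> rfl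

/-- Value of `vT`. [folklore] -/
theorem vT_apply (z : List Bool) : vT z = [decide (vF z = [true])] := eqC_apply _ _ _

/-- Value of `v'T`. [folklore] -/
theorem v'T_apply (z : List Bool) : v'T z = [decide (vF z = [true]) && !headBit (coF z)] := by
  rw [v'T, andFn_apply (vT_apply z) (notFn_apply (show cT z = [headBit (coF z)] by simp [cT]))]

/-- Value of `wiT`. [folklore] -/
theorem wiT_apply (z : List Bool) : wiT z = [headBit (bitAtFn (boolPair (uiF z) (wF z)))] := by
  simp [wiT]

/-- Value of `wjT`. [folklore] -/
theorem wjT_apply (z : List Bool) : wjT z = [headBit (bitAtFn (boolPair (ujF z) (wF z)))] := by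
  simp [wjT]

/-! ### Lengths on every string -/

/-- A written label is at most one bit longer. [folklore] -/
theorem length_setF_le (u b : List Bool → List Bool) (z : List Bool) (hb : (b z).length ≤ 1) :
    (setF u b z).length ≤ (wF z).length + 1 := by
  rw [setF_apply, List.length_append, List.length_append, List.length_take, List.length_drop]
  omega

/-- An updated phase has fewer than `8` symbols. [folklore] -/
theorem length_addPh_le (k : ℕ) (z : List Bool) : (addPh k z).length ≤ 7 := by
  rw [addPh_apply]
  have := Nat.mod_lt ((phF z).length + k) (show 0 < 8 by norm_num)
  simp only [ones, List.length_replicate]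
  omega

/-- A conditional phase update has fewer than `8` symbols. [folklore] -/
theorem length_itePh_le {c : List Bool → List Bool} {z : List Bool} {x : Bool} (hc : c z = [x]) (k l : ℕ) :
    (iteFn c (addPh k) (addPh l) z).length ≤ 7 := by
  rw [iteFn_apply hc]
  split_ifs <;> exact length_addPh_le _ _

/-- The length of a record in terms of its fields. [folklore] -/
theorem length_rec6 (d E co w ph v : List Bool) :
    (rec6 d E co w ph v).length = 2 * (d.length + E.length + co.length + w.length + ph.length) + v.length + 10 := by
  simp only [rec6, length_boolPair]; ring

/-- The constant bounding the growth of one round. [folklore] -/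
def roundGrowth : ℕ := 30

/-- Constant growth of the branch `hR`, on every string. [folklore] -/
theorem length_hR_le (z : List Bool) : (hR z).length ≤ z.length + roundGrowth := by
  have hf := length_fields_le z
  have h1 : (e'F z).length ≤ (eF z).length := by
    have := length_fstF_sndF_le (eF z); simp only [e'F, Function.comp_apply]; omega
  have h2 : (co'F z).length ≤ (coF z).length := by simp [co'F]
  have h3 := length_setF_le uiF cT z (by simp [cT])
  have h4 := length_itePh_le (z := z) (andFn_apply (wiT_apply z) (show cT z = [headBit (coF z)] by simp [cT])) 4 0
  have h5 : (vT z).length = 1 := by rw [vT_apply]; rfl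
  rw [hR, mk6_apply, length_rec6]
  simp only [roundGrowth]
  omega

/-- Constant growth of the branch `sR`, on every string. [folklore] -/
theorem length_sR_le (z : List Bool) : (sR z).length ≤ z.length + roundGrowth := by
  have hf := length_fields_le z
  have h1 : (e'F z).length ≤ (eF z).length := by
    have := length_fstF_sndF_le (eF z); simp only [e'F, Function.comp_apply]; omega
  have h2 : (co'F z).length ≤ (coF z).length := by simp [co'F]
  have h4 := length_itePh_le (wiT_apply z) 2 0
  have h5 : (v'T z).length = 1 := by rw [v'T_apply]; rfl
  rw [sR, mk6_apply, length_rec6]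
  simp only [roundGrowth]
  omega

/-- Constant growth of the branch `tR`, on every string. [folklore] -/
theorem length_tR_le (z : List Bool) : (tR z).length ≤ z.length + roundGrowth := by
  have hf := length_fields_le z
  have h1 : (e'F z).length ≤ (eF z).length := by
    have := length_fstF_sndF_le (eF z); simp only [e'F, Function.comp_apply]; omega
  have h2 : (co'F z).length ≤ (coF z).length := by simp [co'F]
  have h4 := length_itePh_le (wiT_apply z) 1 0
  have h5 : (v'T z).length = 1 := by rw [v'T_apply]; rfl
  rw [tR, mk6_apply, length_rec6]
  simp only [roundGrowth]
  omega

/-- Constant growth of the branch `cR`, on every string. [folklore] -/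
theorem length_cR_le (z : List Bool) : (cR z).length ≤ z.length + roundGrowth := by
  have hf := length_fields_le z
  have h1 : (e'F z).length ≤ (eF z).length := by
    have := length_fstF_sndF_le (eF z); simp only [e'F, Function.comp_apply]; omega
  have h2 : (co'F z).length ≤ (coF z).length := by simp [co'F]
  have h3 := length_setF_le ujF (xorT wjT wiT) z (by rw [xorT_apply (wjT_apply z) (wiT_apply z)]; rfl)
  have h4 := length_addPh_le 0 z
  have h5 : (v'T z).length = 1 := by rw [v'T_apply]; rfl
  rw [cR, mk6_apply, length_rec6]
  simp only [roundGrowth]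
  omega

/-- Constant growth of the branch `idleR`, on every string. [folklore] -/
theorem length_idleR_le (z : List Bool) : (idleR z).length ≤ z.length + roundGrowth := by
  have hf := length_fields_le z
  rw [idleR, mk6_apply, length_rec6]
  simp only [roundGrowth]
  omega

/-- `roundF` as an honest case distinction, on every string. [folklore] -/
theorem roundF_eq (z : List Bool) :
    roundF z = if eF z = [] then idleR z else if opF z = [] then hR z else
      if opF z = [true] then sR z else if opF z = [false, true] then tR z else cR z := by
  rw [roundF, iteFn_apply (nilT_apply eF z)]
  by_cases h0 : eF z = []
  · simp [h0]
  rw [if_neg (by simpa using h0), if_neg h0, iteFn_apply (nilT_apply opF z)]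
  by_cases h1 : opF z = []
  · simp [h1]
  rw [if_neg (by simpa using h1), if_neg h1, iteFn_apply (eqC_apply _ opF z)]
  by_cases h2 : opF z = [true]
  · simp [h2]
  rw [if_neg (by simpa using h2), if_neg h2, iteFn_apply (eqC_apply _ opF z)]
  by_cases h3 : opF z = [false, true]
  · simp [h3]
  · rw [if_neg (by simpa using h3), if_neg h3]

/-- **Constant growth**: `|roundF z| ≤ |z| + 30` on every string. [folklore] -/
theorem length_roundF_le (z : List Bool) : (roundF z).length ≤ z.length + roundGrowth := by
  rw [roundF_eq]
  split_ifs
  exacts [length_idleR_le z, length_hR_le z, length_sR_le z, length_tR_le z, length_cR_le z]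

/-- **The first field is kept**, on every string. [folklore] -/
theorem fstF_roundF (z : List Bool) : fstF (roundF z) = fstF z := by
  rw [roundF_eq]
  split_ifs <;> simp [idleR, hR, sR, tR, cR, Brick.nthF_zero]

/-! ### The clocked walk -/

/-- **The walk**: `|d|` rounds of `roundF` (every gate code has at least two symbols, so the
description is longer than the number of gates). [cite: AroraBarak2009, §1.4.1 (clocked loops)] -/
def passF : List Bool → List Bool := fun r => roundF^[(X : Polynomial ℕ).eval (fstF r).length] r

/-- **`passF ∈ FP`** (`iterate_mem_FP_of_growth`). [cite: AroraBarak2009, §1.3, §1.4.1] -/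
theorem passF_mem_FP : passF ∈ FP :=
  iterate_mem_FP_of_growth roundF_mem_FP roundGrowth fstF_roundF
    (fun w => (length_roundF_le w).trans (by nlinarith [Nat.zero_le (boolUnpair w).1.length])) X

/-! ### Gate codes -/

variable {N : ℕ}

/-- The code of a placed `H` gate. [cite: AroraBarak2009, §6.1 (descriptions of circuits)] -/
theorem encode_gateH (e : Fin (cliffordT.arity CliffordTOp.H) ↪ Fin N) :
    QGate.encode (QGate.gate CliffordTOp.H e : QGate cliffordT N) =
      false :: boolPair [] (boolPair [true] (boolPair (encodeNat (embH e 0)) [])) := by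
  change false :: boolPair (encodeNat 0) (boolPair (unaryEncodeNat 1)
    (List.foldr (fun a acc => boolPair (encodeNat a) acc) []
      (List.ofFn fun i : Fin 1 => ((embH e i : Fin N) : ℕ)))) = _
  have h : encodeNat 0 = [] := by decide
  simp [h]
  rfl

/-- The code of a placed `S` gate. [cite: AroraBarak2009, §6.1 (descriptions of circuits)] -/
theorem encode_gateS (e : Fin (cliffordT.arity CliffordTOp.S) ↪ Fin N) :
    QGate.encode (QGate.gate CliffordTOp.S e : QGate cliffordT N) =
      false :: boolPair [true] (boolPair [true] (boolPair (encodeNat (embS e 0)) [])) := by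
  change false :: boolPair (encodeNat 1) (boolPair (unaryEncodeNat 1)
    (List.foldr (fun a acc => boolPair (encodeNat a) acc) []
      (List.ofFn fun i : Fin 1 => ((embS e i : Fin N) : ℕ)))) = _
  have h : encodeNat 1 = [true] := by decide
  simp [h]
  rfl

/-- The code of a placed `T` gate. [cite: AroraBarak2009, §6.1 (descriptions of circuits)] -/
theorem encode_gateT (e : Fin (cliffordT.arity CliffordTOp.T) ↪ Fin N) :
    QGate.encode (QGate.gate CliffordTOp.T e : QGate cliffordT N) =
      false :: boolPair [false, true] (boolPair [true] (boolPair (encodeNat (embT e 0)) [])) := by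
  change false :: boolPair (encodeNat 2) (boolPair (unaryEncodeNat 1)
    (List.foldr (fun a acc => boolPair (encodeNat a) acc) []
      (List.ofFn fun i : Fin 1 => ((embT e i : Fin N) : ℕ)))) = _
  have h : encodeNat 2 = [false, true] := by decide
  simp [h]
  rfl

/-- The code of a placed `CNOT` gate. [cite: AroraBarak2009, §6.1 (descriptions of circuits)] -/
theorem encode_gateCNOT (e : Fin (cliffordT.arity CliffordTOp.CNOT) ↪ Fin N) :
    QGate.encode (QGate.gate CliffordTOp.CNOT e : QGate cliffordT N) =
      false :: boolPair [true, true] (boolPair [true, true]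
        (boolPair (encodeNat (embC e 0)) (boolPair (encodeNat (embC e 1)) []))) := by
  change false :: boolPair (encodeNat 3) (boolPair (unaryEncodeNat 2)
    (List.foldr (fun a acc => boolPair (encodeNat a) acc) []
      (List.ofFn fun i : Fin 2 => ((embC e i : Fin N) : ℕ)))) = _
  have h : encodeNat 3 = [true, true] := by decide
  simp [h, List.ofFn_succ]
  rfl

/-! ### Label bits -/

/-- The unary wire number, capped by the label length, is the wire number. [folklore] -/
theorem binToUnaryFn_label (w : QReg N) (i : Fin N) :
    binToUnaryFn (boolPair (List.ofFn w) (encodeNat i)) = ones i := by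
  simp

/-- Reading a label bit at a unary position. [folklore] -/
theorem bitAtFn_label (w : QReg N) (i : Fin N) : bitAtFn (boolPair (ones i) (List.ofFn w)) = [w i] := by
  rw [bitAtFn_boolPair_of_lt _ _ (by simp)]
  simp

/-- `List.ofFn` of an updated function is `List.set`. [folklore] -/
theorem ofFn_update (w : QReg N) (i : Fin N) (c : Bool) :
    List.ofFn (Function.update w i c) = (List.ofFn w).set i c := by
  apply List.ext_getElem
  · simp
  · intro k h1 h2
    simp only [List.getElem_ofFn, List.getElem_set, Function.update_apply, Fin.ext_iff]
    by_cases h : (i : ℕ) = k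
    · simp [h]
    · rw [if_neg (fun h' => h h'.symm), if_neg h]

/-- Writing a label bit at a unary position. [folklore] -/
theorem set_label (w : QReg N) (i : Fin N) (c : Bool) :
    (List.ofFn w).take i ++ [c] ++ (List.ofFn w).drop (i + 1) = List.ofFn (Function.update w i c) := by
  rw [ofFn_update, List.set_eq_take_append_cons_drop, if_pos (by simp)]
  simp

/-! ### One round on a record -/

section RoundSpec

variable (d : List Bool) (l : List (List Bool)) (co : List Bool) (w : QReg N) (ph v : List Bool)

/-- The fields of a record. [folklore] -/
theorem fields_rec6 (E cw wl : List Bool) :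
    dF (rec6 d E cw wl ph v) = d ∧ eF (rec6 d E cw wl ph v) = E ∧ coF (rec6 d E cw wl ph v) = cw ∧
      wF (rec6 d E cw wl ph v) = wl ∧ phF (rec6 d E cw wl ph v) = ph ∧ vF (rec6 d E cw wl ph v) = v := by
  simp [Brick.nthF_zero, nthF, sndPow]

/-- The round on a record whose next gate code is `0 ⟨op, ⟨ar, ⟨bin i, rest⟩⟩⟩`: the parsed
pieces. [folklore] -/
theorem pieces_rec6 (op ar rest : List Bool) (i : Fin N) :
    let z := rec6 d (encList ((false :: boolPair op (boolPair ar (boolPair (encodeNat i) rest))) :: l)) co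
      (List.ofFn w) ph v
    eF z ≠ [] ∧ opF z = op ∧ e'F z = encList l ∧ co'F z = co.tail ∧ cT z = [headBit co] ∧
      coF z = co ∧ jF z = fstF rest ∧ uiF z = ones i ∧ wiT z = [w i] ∧
      dF z = d ∧ wF z = List.ofFn w ∧ phF z = ph ∧ vF z = v := by
  intro z
  have hE : eF z = boolPair (false :: boolPair op (boolPair ar (boolPair (encodeNat i) rest))) (encList l) := by
    simp [z, nthF, encList_cons]
  have hco : coF z = co := by simp [z, nthF]
  have hw : wF z = List.ofFn w := by simp [z, nthF]
  have hop : opF z = op := by simp [opF, gtF, gF, hE]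
  have hi : iF z = encodeNat i := by simp [iF, wsF, gtF, gF, hE]
  have hui : uiF z = ones i := by simp [uiF, hw, hi]
  refine ⟨by simp [hE, boolPair], hop, by simp [e'F, hE], by simp [co'F, hco], by simp [cT, hco], hco,
    by simp [jF, wsF, gtF, gF, hE], hui, ?_, by simp [z, Brick.nthF_zero], hw, by simp [z, nthF],
    by simp [z, sndPow]⟩
  rw [wiT_apply, hui, hw, bitAtFn_label]
  simp [headBit]

/-- The length of a phase register. [folklore] -/
theorem length_ones (φ : ℕ) : (ones φ).length = φ := List.length_replicate

/-- One round on an `H` gate. [cite: AdlemanDeMarraisHuang1997, §6 Lemma 6.10 (proof, step 3)] -/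
theorem roundF_rec_H (e : Fin (cliffordT.arity CliffordTOp.H) ↪ Fin N) (φ : ℕ) (vb : Bool) :
    roundF (rec6 d (encList ((QGate.gate CliffordTOp.H e : QGate cliffordT N).encode :: l)) co
        (List.ofFn w) (ones φ) [vb]) =
      rec6 d (encList l) co.tail (List.ofFn (Function.update w (embH e 0) (headBit co)))
        (ones ((φ + if w (embH e 0) && headBit co then 4 else 0) % 8)) [vb] := by
  rw [encode_gateH]
  obtain ⟨hE, hop, he', hco', hcT, -, -, hui, hwi, hd, hw, hph, hv⟩ :=
    pieces_rec6 d l co w (ones φ) [vb] [] [true] [] (embH e 0)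
  set z := rec6 d (encList ((false :: boolPair [] (boolPair [true] (boolPair (encodeNat (embH e 0)) []))) :: l))
    co (List.ofFn w) (ones φ) [vb] with hz
  have h1 : setF uiF cT z = List.ofFn (Function.update w (embH e 0) (headBit co)) := by
    rw [setF_apply, hui, hcT, hw]
    simpa using set_label w (embH e 0) (headBit co)
  have h2 : iteFn (andFn wiT cT) (addPh 4) (addPh 0) z =
      ones ((φ + if w (embH e 0) && headBit co then 4 else 0) % 8) := by
    rw [iteFn_apply (andFn_apply hwi hcT), addPh_apply, addPh_apply, hph, length_ones]
    cases w (embH e 0) <;> cases headBit co <;> simp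
  have h3 : vT z = [vb] := by
    rw [vT_apply, hv]
    cases vb <;> simp
  rw [roundF_eq, if_neg hE, if_pos hop, hR, mk6_apply, hd, he', hco', h1, h2, h3]

/-- One round on an `S` gate. [cite: AdlemanDeMarraisHuang1997, §6 Lemma 6.10 (proof, step 3)] -/
theorem roundF_rec_S (e : Fin (cliffordT.arity CliffordTOp.S) ↪ Fin N) (φ : ℕ) (vb : Bool) :
    roundF (rec6 d (encList ((QGate.gate CliffordTOp.S e : QGate cliffordT N).encode :: l)) co
        (List.ofFn w) (ones φ) [vb]) =
      rec6 d (encList l) co.tail (List.ofFn w)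
        (ones ((φ + if w (embS e 0) then 2 else 0) % 8)) [vb && !headBit co] := by
  rw [encode_gateS]
  obtain ⟨hE, hop, he', hco', -, hco, -, -, hwi, hd, hw, hph, hv⟩ :=
    pieces_rec6 d l co w (ones φ) [vb] [true] [true] [] (embS e 0)
  set z := rec6 d (encList ((false :: boolPair [true] (boolPair [true] (boolPair (encodeNat (embS e 0)) []))) :: l))
    co (List.ofFn w) (ones φ) [vb] with hz
  have h2 : iteFn wiT (addPh 2) (addPh 0) z = ones ((φ + if w (embS e 0) then 2 else 0) % 8) := by
    rw [iteFn_apply hwi, addPh_apply, addPh_apply, hph, length_ones]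
    cases w (embS e 0) <;> simp
  have h3 : v'T z = [vb && !headBit co] := by
    rw [v'T_apply, hv, hco]
    cases vb <;> simp
  have hop0 : opF z ≠ [] := by simp [hop]
  rw [roundF_eq, if_neg hE, if_neg hop0, if_pos hop, sR, mk6_apply, hd, he', hco', hw, h2, h3]

/-- One round on a `T` gate. [cite: AdlemanDeMarraisHuang1997, §6 Lemma 6.10 (proof, step 3)] -/
theorem roundF_rec_T (e : Fin (cliffordT.arity CliffordTOp.T) ↪ Fin N) (φ : ℕ) (vb : Bool) :
    roundF (rec6 d (encList ((QGate.gate CliffordTOp.T e : QGate cliffordT N).encode :: l)) co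
        (List.ofFn w) (ones φ) [vb]) =
      rec6 d (encList l) co.tail (List.ofFn w)
        (ones ((φ + if w (embT e 0) then 1 else 0) % 8)) [vb && !headBit co] := by
  rw [encode_gateT]
  obtain ⟨hE, hop, he', hco', -, hco, -, -, hwi, hd, hw, hph, hv⟩ :=
    pieces_rec6 d l co w (ones φ) [vb] [false, true] [true] [] (embT e 0)
  set z := rec6 d (encList ((false :: boolPair [false, true]
    (boolPair [true] (boolPair (encodeNat (embT e 0)) []))) :: l)) co (List.ofFn w) (ones φ) [vb] with hz
  have h2 : iteFn wiT (addPh 1) (addPh 0) z = ones ((φ + if w (embT e 0) then 1 else 0) % 8) := by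
    rw [iteFn_apply hwi, addPh_apply, addPh_apply, hph, length_ones]
    cases w (embT e 0) <;> simp
  have h3 : v'T z = [vb && !headBit co] := by
    rw [v'T_apply, hv, hco]
    cases vb <;> simp
  have hop0 : opF z ≠ [] := by simp [hop]
  have hop1 : opF z ≠ [true] := by simp [hop]
  rw [roundF_eq, if_neg hE, if_neg hop0, if_neg hop1, if_pos hop, tR, mk6_apply, hd, he', hco', hw, h2, h3]

/-- One round on a `CNOT` gate. [cite: AdlemanDeMarraisHuang1997, §6 Lemma 6.10 (proof, step 3)] -/
theorem roundF_rec_CNOT (e : Fin (cliffordT.arity CliffordTOp.CNOT) ↪ Fin N) (φ : ℕ) (vb : Bool) :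
    roundF (rec6 d (encList ((QGate.gate CliffordTOp.CNOT e : QGate cliffordT N).encode :: l)) co
        (List.ofFn w) (ones φ) [vb]) =
      rec6 d (encList l) co.tail
        (List.ofFn (Function.update w (embC e 1) (w (embC e 1) ^^ w (embC e 0))))
        (ones (φ % 8)) [vb && !headBit co] := by
  rw [encode_gateCNOT]
  obtain ⟨hE, hop, he', hco', -, hco, hj, -, hwi, hd, hw, hph, hv⟩ :=
    pieces_rec6 d l co w (ones φ) [vb] [true, true] [true, true] (boolPair (encodeNat (embC e 1)) []) (embC e 0)
  set z := rec6 d (encList ((false :: boolPair [true, true] (boolPair [true, true]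
    (boolPair (encodeNat (embC e 0)) (boolPair (encodeNat (embC e 1)) [])))) :: l)) co (List.ofFn w)
    (ones φ) [vb] with hz
  have hjv : jF z = encodeNat (embC e 1) := by rw [hj, fstF_boolPair]
  have huj : ujF z = ones (embC e 1) := by
    show binToUnaryFn (fanoutFn wF jF z) = _
    rw [fanoutFn_apply, hw, hjv, binToUnaryFn_label]
  have hwj : wjT z = [w (embC e 1)] := by
    rw [wjT_apply, huj, hw, bitAtFn_label]
    simp [headBit]
  have h1 : setF ujF (xorT wjT wiT) z =
      List.ofFn (Function.update w (embC e 1) (w (embC e 1) ^^ w (embC e 0))) := by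
    rw [setF_apply, huj, xorT_apply hwj hwi, hw]
    simpa using set_label w (embC e 1) (w (embC e 1) ^^ w (embC e 0))
  have h2 : addPh 0 z = ones (φ % 8) := by
    rw [addPh_apply, hph, length_ones, Nat.add_zero]
  have h3 : v'T z = [vb && !headBit co] := by
    rw [v'T_apply, hv, hco]
    cases vb <;> simp
  have hop0 : opF z ≠ [] := by simp [hop]
  have hop1 : opF z ≠ [true] := by simp [hop]
  have hop2 : opF z ≠ [false, true] := by simp [hop]
  rw [roundF_eq, if_neg hE, if_neg hop0, if_neg hop1, if_neg hop2, cR, mk6_apply, hd, he', hco', h1, h2, h3]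

/-- **One round is one total step.** On the record of a walk whose next gate is the oracle-free
gate `g`, `roundF` computes `ADH.tStep g` on the choice bit read off the coins (label as the bit
list `List.ofFn`, phase `φ` as `1^φ` reduced modulo `8`, flag as one bit).
[cite: AdlemanDeMarraisHuang1997, §6 Lemma 6.10 (proof, step 3)] -/
theorem roundF_rec (g : QGate cliffordT N) (hg : g.IsOracleFree) (φ : ℕ) (vb : Bool) :
    roundF (rec6 d (encList (g.encode :: l)) co (List.ofFn w) (ones φ) [vb]) =
      rec6 d (encList l) co.tail (List.ofFn (tStep g (headBit co) (w, φ, vb)).1)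
        (ones (tStep g (headBit co) (w, φ, vb)).2.1) [(tStep g (headBit co) (w, φ, vb)).2.2] := by
  cases g with
  | oracle k e => exact absurd hg id
  | gate op e =>
    cases op with
    | H => exact roundF_rec_H d l co w e φ vb
    | S => exact roundF_rec_S d l co w e φ vb
    | T => exact roundF_rec_T d l co w e φ vb
    | CNOT => exact roundF_rec_CNOT d l co w e φ vb

end RoundSpec

/-! ### The walk on a record -/

/-- A record with no gate ahead is fixed by the round. [folklore] -/
theorem roundF_idle (d co wl ph v : List Bool) : roundF (rec6 d [] co wl ph v) = rec6 d [] co wl ph v := by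
  have hE : eF (rec6 d [] co wl ph v) = [] := by simp [nthF]
  rw [roundF_eq, if_pos hE, idleR, mk6_apply]
  obtain ⟨h0, h1, h2, h3, h4, h5⟩ := fields_rec6 d ph v [] co wl
  rw [h0, h1, h2, h3, h4, h5]

/-- **Enough rounds walk the whole gate list** (`ADH.tRun`), consuming one coin per gate, and then
idle. [cite: AdlemanDeMarraisHuang1997, §6 Lemma 6.10 (proof, step 3)] -/
theorem iterate_roundF (d : List Bool) (gs : List (QGate cliffordT N)) (hgs : ∀ g ∈ gs, g.IsOracleFree) :
    ∀ (k : ℕ) (co : List Bool) (s : TState N), gs.length ≤ k →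
    roundF^[k] (rec6 d (encList (gs.map QGate.encode)) co (List.ofFn s.1) (ones s.2.1) [s.2.2]) =
      rec6 d [] (co.drop gs.length) (List.ofFn (tRun gs co s).1) (ones (tRun gs co s).2.1)
        [(tRun gs co s).2.2] := by
  induction gs with
  | nil =>
    intro k co s _
    simp only [List.map_nil, encList_nil, List.length_nil, List.drop_zero, tRun]
    exact Function.iterate_fixed (roundF_idle d co _ _ _) k
  | cons g gs ih =>
    intro k co s hk
    rw [List.length_cons] at hk
    obtain ⟨k, rfl⟩ : ∃ k', k = k' + 1 := Nat.exists_eq_add_one.2 (by omega)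
    obtain ⟨w, φ, vb⟩ := s
    rw [Function.iterate_succ_apply, List.map_cons,
      roundF_rec d (gs.map QGate.encode) co w g (hgs g (by simp)) φ vb,
      ih (fun g' hg' => hgs g' (by simp [hg'])) k co.tail _ (by omega)]
    simp [tRun, List.drop_tail]

/-- The walk on a record: `passF` runs `|d|` rounds. [folklore] -/
theorem passF_rec6 (d E co wl ph v : List Bool) :
    passF (rec6 d E co wl ph v) = roundF^[d.length] (rec6 d E co wl ph v) := by
  simp [passF, fstF]

/-! ### The description of the circuit -/

section Desc

variable (F : QCircuitFamily cliffordT) (x : List Bool)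

/-- The gate codes of the `|x|`-th circuit. [folklore] -/
def codes : List (List Bool) := ((F.circ x.length).gates).map QGate.encode

/-- The description splits as `⟨bin n, ⟨1^m, encList codes⟩⟩`. [cite: AroraBarak2009, §6.1–6.2 (descriptions of circuit families)] -/
theorem descFn_eq : F.descFn x = boolPair (encodeNat x.length)
    (boolPair (ones (F.ancillas x.length)) (encList (codes F x))) := by
  rw [QCircuitFamily.descFn, QCircuit.sigmaEncode_eq, QCircuit.encode_eq_encList,
    OracleCompose.unaryEncodeNat_eq_replicate]
  rfl

/-- A coded list is at least twice as long as the list. [folklore] -/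
theorem two_mul_length_le_length_encList (l : List (List Bool)) : 2 * l.length ≤ (encList l).length := by
  induction l with
  | nil => simp
  | cons a l ih => rw [encList_cons, length_boolPair, List.length_cons]; omega

/-- The description is longer than the number of gates (every gate code has at least two
symbols), so `|d|` rounds walk the whole circuit. [folklore] -/
theorem length_gates_le_length_descFn : (F.circ x.length).gates.length ≤ (F.descFn x).length := by
  have h := two_mul_length_le_length_encList (codes F x)
  have hl : (codes F x).length = (F.circ x.length).gates.length := List.length_map _
  rw [descFn_eq, length_boolPair, length_boolPair]
  omega

end Desc

/-! ### The whole predicate -/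

section Whole

variable (F : QCircuitFamily cliffordT)

/-- The description of the `|x|`-th circuit, from `⟨x, y⟩`. [folklore] -/
def descF : List Bool → List Bool := F.descFn ∘ fstF
/-- The gate codes, from `⟨x, y⟩`. [folklore] -/
def codesF : List Bool → List Bool := sndF ∘ sndF ∘ descF F
/-- The ancilla count `1^m`, from `⟨x, y⟩`. [folklore] -/
def onesMF : List Bool → List Bool := fstF ∘ sndF ∘ descF F
/-- The padded input label `x 0^m`, from `⟨x, y⟩`. [folklore] -/
def w0F : List Bool → List Bool := OracleCompose.concatFn ∘ pr fstF (Kannan.zerosFn ∘ onesMF F)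
/-- The record of the first walk: all gates ahead, all coins unread, phase `0`, valid. [folklore] -/
def rec1F : List Bool → List Bool := mk6 (descF F) (codesF F) sndF (w0F F) (fun _ => []) (fun _ => [true])
/-- The first walk. [cite: AdlemanDeMarraisHuang1997, §6 Lemma 6.10 (proof, step 3: "Use P₁ to choose a path")] -/
def pass1F : List Bool → List Bool := passF ∘ rec1F F
/-- The input together with the result of the first walk. [folklore] -/
def pairF : List Bool → List Bool := pr id (pass1F F)
/-- The record of the second walk (on the coins the first walk left). [folklore] -/
def rec2F : List Bool → List Bool :=
  mk6 (descF F ∘ fstF) (codesF F ∘ fstF) (coF ∘ sndF) (w0F F ∘ fstF) (fun _ => []) (fun _ => [true])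
/-- The results of both walks, `⟨R₁, R₂⟩`. [cite: AdlemanDeMarraisHuang1997, §6 Lemma 6.10 (proof, step 3: "Similarly, use P₂ to choose a second path")] -/
def twoF : List Bool → List Bool := pr sndF (passF ∘ rec2F F) ∘ pairF F

/-- `descF` is in `FP` (composition of bricks). [folklore] -/
theorem descF_mem_FP (hU : F.IsUniform) : descF F ∈ FP :=
  comp_mem_FP (QCircuitFamily.descFn_mem_FP_of_isUniform hU) fstF_mem_FP
/-- `codesF` is in `FP` (composition of bricks). [folklore] -/
theorem codesF_mem_FP (hU : F.IsUniform) : codesF F ∈ FP :=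
  comp_mem_FP sndF_mem_FP (comp_mem_FP sndF_mem_FP (descF_mem_FP F hU))
/-- `onesMF` is in `FP` (composition of bricks). [folklore] -/
theorem onesMF_mem_FP (hU : F.IsUniform) : onesMF F ∈ FP :=
  comp_mem_FP fstF_mem_FP (comp_mem_FP sndF_mem_FP (descF_mem_FP F hU))
/-- `w0F` is in `FP` (composition of bricks). [folklore] -/
theorem w0F_mem_FP (hU : F.IsUniform) : w0F F ∈ FP :=
  comp_mem_FP OracleCompose.concatFn_mem_FP (fanoutFn_mem_FP fstF_mem_FP
    (comp_mem_FP Kannan.zerosFn_mem_FP (onesMF_mem_FP F hU)))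
/-- `rec1F` is in `FP` (composition of bricks). [folklore] -/
theorem rec1F_mem_FP (hU : F.IsUniform) : rec1F F ∈ FP :=
  mk6_mem_FP (descF_mem_FP F hU) (codesF_mem_FP F hU) sndF_mem_FP (w0F_mem_FP F hU) (const_mem_FP _) (const_mem_FP _)
/-- `pass1F` is in `FP` (composition of bricks). [folklore] -/
theorem pass1F_mem_FP (hU : F.IsUniform) : pass1F F ∈ FP := comp_mem_FP passF_mem_FP (rec1F_mem_FP F hU)
/-- `pairF` is in `FP` (composition of bricks). [folklore] -/
theorem pairF_mem_FP (hU : F.IsUniform) : pairF F ∈ FP := fanoutFn_mem_FP OracleCompose.id_mem_FP (pass1F_mem_FP F hU)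
/-- `rec2F` is in `FP` (composition of bricks). [folklore] -/
theorem rec2F_mem_FP (hU : F.IsUniform) : rec2F F ∈ FP :=
  mk6_mem_FP (comp_mem_FP (descF_mem_FP F hU) fstF_mem_FP) (comp_mem_FP (codesF_mem_FP F hU) fstF_mem_FP)
    (comp_mem_FP (nthF_mem_FP 2) sndF_mem_FP) (comp_mem_FP (w0F_mem_FP F hU) fstF_mem_FP)
    (const_mem_FP _) (const_mem_FP _)
/-- `twoF` is in `FP` (composition of bricks). [folklore] -/
theorem twoF_mem_FP (hU : F.IsUniform) : twoF F ∈ FP :=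
  comp_mem_FP (fanoutFn_mem_FP sndF_mem_FP (comp_mem_FP passF_mem_FP (rec2F_mem_FP F hU))) (pairF_mem_FP F hU)

variable (x y : List Bool)

/-- The padded input label of the `|x|`-th circuit. [folklore] -/
def w₀ : QReg (x.length + F.ancillas x.length) := padInput x.get (F.ancillas x.length)

/-- The first record, on `⟨x, y⟩`. [folklore] -/
theorem rec1F_boolPair : rec1F F (boolPair x y) =
    rec6 (F.descFn x) (encList (codes F x)) y (List.ofFn (w₀ F x)) (ones 0) [true] := by
  simp [rec1F, descF, codesF, onesMF, w0F, descFn_eq, w₀, ofFn_padInput, fstF, sndF]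

variable (hF : F.IsOracleFree)
include hF

/-- The gates of an oracle-free family are oracle-free. [folklore] -/
theorem gates_isOracleFree (n : ℕ) : ∀ g ∈ (F.circ n).gates, g.IsOracleFree := hF n

/-- **The first walk** on `⟨x, y⟩`. [cite: AdlemanDeMarraisHuang1997, §6 Lemma 6.10 (proof, step 3)] -/
theorem pass1F_boolPair :
    pass1F F (boolPair x y) =
      (let gs := (F.circ x.length).gates
       let r := tRun gs y (w₀ F x, 0, true)
       rec6 (F.descFn x) [] (y.drop gs.length) (List.ofFn r.1) (ones r.2.1) [r.2.2]) := by
  simp only [pass1F, Function.comp_apply, rec1F_boolPair, passF_rec6]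
  exact iterate_roundF (F.descFn x) _ (gates_isOracleFree F hF x.length) _ y (w₀ F x, 0, true)
    (length_gates_le_length_descFn F x)

/-- **Both walks** on `⟨x, y⟩`: the second walk reads the coins the first one left.
[cite: AdlemanDeMarraisHuang1997, §6 Lemma 6.10 (proof, step 3)] -/
theorem twoF_boolPair :
    twoF F (boolPair x y) =
      (let gs := (F.circ x.length).gates
       let r := tRun gs y (w₀ F x, 0, true)
       let r' := tRun gs (y.drop gs.length) (w₀ F x, 0, true)
       boolPair (rec6 (F.descFn x) [] (y.drop gs.length) (List.ofFn r.1) (ones r.2.1) [r.2.2])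
         (rec6 (F.descFn x) [] ((y.drop gs.length).drop gs.length) (List.ofFn r'.1) (ones r'.2.1) [r'.2.2])) := by
  have h1 := pass1F_boolPair F x y hF
  simp only at h1
  have h2 : rec2F F (boolPair (boolPair x y) (pass1F F (boolPair x y))) =
      rec6 (F.descFn x) (encList (codes F x)) (y.drop (F.circ x.length).gates.length)
        (List.ofFn (w₀ F x)) (ones 0) [true] := by
    rw [h1]
    simp [rec2F, descF, codesF, w0F, onesMF, descFn_eq, w₀, ofFn_padInput, fstF, sndF, nthF]
  have h3 : passF (rec6 (F.descFn x) (encList (codes F x)) (y.drop (F.circ x.length).gates.length)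
      (List.ofFn (w₀ F x)) (ones 0) [true]) =
      (let gs := (F.circ x.length).gates
       let r' := tRun gs (y.drop gs.length) (w₀ F x, 0, true)
       rec6 (F.descFn x) [] ((y.drop gs.length).drop gs.length) (List.ofFn r'.1) (ones r'.2.1) [r'.2.2]) := by
    rw [passF_rec6]
    exact iterate_roundF (F.descFn x) _ (gates_isOracleFree F hF x.length) _ _ (w₀ F x, 0, true)
      (length_gates_le_length_descFn F x)
  simp only at h3
  show fanoutFn sndF (passF ∘ rec2F F) (fanoutFn id (pass1F F) (boolPair x y)) = _
  rw [fanoutFn_apply, fanoutFn_apply]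
  simp only [Function.comp_apply, id, sndF_boolPair]
  rw [h2, h3, h1]

end Whole

/-! ### The verdict on three more coins -/

section Verdict

/-- Label of the first walk. [folklore] -/
abbrev w1F : List Bool → List Bool := wF ∘ fstF
/-- Phase of the first walk. [folklore] -/
abbrev ph1F : List Bool → List Bool := phF ∘ fstF
/-- Flag of the first walk. [folklore] -/
abbrev v1F : List Bool → List Bool := vF ∘ fstF
/-- Label of the second walk. [folklore] -/
abbrev w2F : List Bool → List Bool := wF ∘ sndF
/-- Phase of the second walk. [folklore] -/
abbrev ph2F : List Bool → List Bool := phF ∘ sndF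
/-- Flag of the second walk. [folklore] -/
abbrev v2F : List Bool → List Bool := vF ∘ sndF
/-- Coins left by the second walk (the first three are the extra guess `c`). [folklore] -/
abbrev co2F : List Bool → List Bool := coF ∘ sndF

/-- "Nontrivial guess": both walks valid and ending at the same label.
[cite: AdlemanDeMarraisHuang1997, §6 Lemma 6.10 (proof, step 4(i): "If C₁ ≠ C₂, then output yes if E = 0 and no if E = 1")] -/
def okT : List Bool → List Bool := andFn (eqC [true] v1F) (andFn (eqC [true] v2F) (eqPairFn ∘ pr w1F w2F))
/-- The acceptance sign: wire `0` of the common final label reads `1`.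
[cite: AdlemanDeMarraisHuang1997, §6 Lemma 6.10 (proof, step 5: "yes if C₁ is an accept configuration")] -/
def sgT : List Bool → List Bool := bitT w1F
/-- The three extra coins. [cite: AdlemanDeMarraisHuang1997, §6 Lemma 6.10 (proof, step 2: the guesses G₁, G₂, E)] -/
def c0T : List Bool → List Bool := bitT co2F
/-- The second extra coin. [cite: AdlemanDeMarraisHuang1997, §6 Lemma 6.10 (proof, step 2: the guesses G₁, G₂, E)] -/
def c1T : List Bool → List Bool := bitT (List.tail ∘ co2F)
/-- The third extra coin. [cite: AdlemanDeMarraisHuang1997, §6 Lemma 6.10 (proof, step 2: the guesses G₁, G₂, E)] -/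
def c2T : List Bool → List Bool := bitT (List.tail ∘ List.tail ∘ co2F)
/-- Seven copies of a field, concatenated. [folklore] -/
def rep7 (f : List Bool → List Bool) : List Bool → List Bool :=
  OracleCompose.concatFn ∘ pr f (OracleCompose.concatFn ∘ pr f (OracleCompose.concatFn ∘ pr f
    (OracleCompose.concatFn ∘ pr f (OracleCompose.concatFn ∘ pr f (OracleCompose.concatFn ∘ pr f f)))))
/-- The phase-difference class `(φ₁ − φ₂) mod 8 = (φ₁ + 7 φ₂) mod 8`, in unary.
[cite: AdlemanDeMarraisHuang1997, §6 Lemma 6.10 (proof, step 5: comparing the signs of a_{P₁,0}, a_{P₂,0})] -/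
def diffF : List Bool → List Bool :=
  modLenFn ∘ pr (fun _ => ones 8) (OracleCompose.concatFn ∘ pr ph1F (rep7 ph2F))
/-- "The class is `k`". [folklore] -/
def isD (k : ℕ) : List Bool → List Bool := eqC (ones k) diffF
/-- Answers for weight `+4·sign`: always / never. [folklore] -/
def V4 : List Bool → List Bool := iteFn sgT (fun _ => [true]) (fun _ => [false])
/-- Answers for weight `−4·sign`. [folklore] -/
def Vm4 : List Bool → List Bool := iteFn sgT (fun _ => [false]) (fun _ => [true])
/-- All three extra coins are `1` (`⟦c⟧ = 7`). [folklore] -/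
def all3 : List Bool → List Bool := andFn c0T (andFn c1T c2T)
/-- All three extra coins are `0` (`⟦c⟧ = 0`). [folklore] -/
def none3 : List Bool → List Bool := andFn (notFn c0T) (andFn (notFn c1T) (notFn c2T))
/-- Answers for weight `+3·sign`: `⟦c⟧ < 7` / `⟦c⟧ < 1`. [folklore] -/
def V3 : List Bool → List Bool := iteFn sgT (notFn all3) none3
/-- Answers for weight `−3·sign`. [folklore] -/
def Vm3 : List Bool → List Bool := iteFn sgT none3 (notFn all3)
/-- Answers for weight `0` (and trivial guesses): `⟦c⟧ < 4`. [folklore] -/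
def V0 : List Bool → List Bool := notFn c2T

/-- **The verdict**: "yes" iff `⟦c⟧ < 4 + wt`, by cases on the validity test, the class and the
sign. [cite: AdlemanDeMarraisHuang1997, §6 Lemma 6.10 (proof, steps 4–5)] -/
def verdictF : List Bool → List Bool :=
  iteFn okT (iteFn (isD 0) V4 (iteFn (isD 4) Vm4 (iteFn (isD 1) V3 (iteFn (isD 7) V3
    (iteFn (isD 3) Vm3 (iteFn (isD 5) Vm3 V0)))))) V0

/-- `okT` is in `FP` (composition of bricks). [folklore] -/
theorem okT_mem_FP : okT ∈ FP :=
  andFn_mem_FP (eqC_mem_FP _ (comp_mem_FP (sndPow_mem_FP 4) fstF_mem_FP))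
    (andFn_mem_FP (eqC_mem_FP _ (comp_mem_FP (sndPow_mem_FP 4) sndF_mem_FP))
      (comp_mem_FP eqPairFn_mem_FP (fanoutFn_mem_FP (comp_mem_FP (nthF_mem_FP 3) fstF_mem_FP)
        (comp_mem_FP (nthF_mem_FP 3) sndF_mem_FP))))
/-- `sgT` is in `FP` (composition of bricks). [folklore] -/
theorem sgT_mem_FP : sgT ∈ FP := bitT_mem_FP (comp_mem_FP (nthF_mem_FP 3) fstF_mem_FP)
/-- `c0T` is in `FP` (composition of bricks). [folklore] -/
theorem c0T_mem_FP : c0T ∈ FP := bitT_mem_FP (comp_mem_FP (nthF_mem_FP 2) sndF_mem_FP)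
/-- `c1T` is in `FP` (composition of bricks). [folklore] -/
theorem c1T_mem_FP : c1T ∈ FP :=
  bitT_mem_FP (comp_mem_FP PRelSigma.tail_mem_FP (comp_mem_FP (nthF_mem_FP 2) sndF_mem_FP))
/-- `c2T` is in `FP` (composition of bricks). [folklore] -/
theorem c2T_mem_FP : c2T ∈ FP :=
  bitT_mem_FP (comp_mem_FP PRelSigma.tail_mem_FP (comp_mem_FP PRelSigma.tail_mem_FP
    (comp_mem_FP (nthF_mem_FP 2) sndF_mem_FP)))
/-- `rep7` is in `FP` (composition of bricks). [folklore] -/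
theorem rep7_mem_FP {f : List Bool → List Bool} (hf : f ∈ FP) : rep7 f ∈ FP := by
  have hc : ∀ {g : List Bool → List Bool}, g ∈ FP → OracleCompose.concatFn ∘ pr f g ∈ FP := fun hg =>
    comp_mem_FP OracleCompose.concatFn_mem_FP (fanoutFn_mem_FP hf hg)
  exact hc (hc (hc (hc (hc (hc hf)))))
/-- `diffF` is in `FP` (composition of bricks). [folklore] -/
theorem diffF_mem_FP : diffF ∈ FP :=
  comp_mem_FP modLenFn_mem_FP (fanoutFn_mem_FP (const_mem_FP _) (comp_mem_FP OracleCompose.concatFn_mem_FP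
    (fanoutFn_mem_FP (comp_mem_FP (nthF_mem_FP 4) fstF_mem_FP) (rep7_mem_FP (comp_mem_FP (nthF_mem_FP 4) sndF_mem_FP)))))
/-- `isD` is in `FP` (composition of bricks). [folklore] -/
theorem isD_mem_FP (k : ℕ) : isD k ∈ FP := eqC_mem_FP _ diffF_mem_FP
/-- `V4` is in `FP` (composition of bricks). [folklore] -/
theorem V4_mem_FP : V4 ∈ FP := iteFn_mem_FP sgT_mem_FP (const_mem_FP _) (const_mem_FP _)
/-- `Vm4` is in `FP` (composition of bricks). [folklore] -/
theorem Vm4_mem_FP : Vm4 ∈ FP := iteFn_mem_FP sgT_mem_FP (const_mem_FP _) (const_mem_FP _)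
/-- `all3` is in `FP` (composition of bricks). [folklore] -/
theorem all3_mem_FP : all3 ∈ FP := andFn_mem_FP c0T_mem_FP (andFn_mem_FP c1T_mem_FP c2T_mem_FP)
/-- `none3` is in `FP` (composition of bricks). [folklore] -/
theorem none3_mem_FP : none3 ∈ FP :=
  andFn_mem_FP (notFn_mem_FP c0T_mem_FP) (andFn_mem_FP (notFn_mem_FP c1T_mem_FP) (notFn_mem_FP c2T_mem_FP))
/-- `V3` is in `FP` (composition of bricks). [folklore] -/
theorem V3_mem_FP : V3 ∈ FP := iteFn_mem_FP sgT_mem_FP (notFn_mem_FP all3_mem_FP) none3_mem_FP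
/-- `Vm3` is in `FP` (composition of bricks). [folklore] -/
theorem Vm3_mem_FP : Vm3 ∈ FP := iteFn_mem_FP sgT_mem_FP none3_mem_FP (notFn_mem_FP all3_mem_FP)
/-- `V0` is in `FP` (composition of bricks). [folklore] -/
theorem V0_mem_FP : V0 ∈ FP := notFn_mem_FP c2T_mem_FP

/-- **`verdictF ∈ FP`.** [cite: AroraBarak2009, §1.3] -/
theorem verdictF_mem_FP : verdictF ∈ FP :=
  iteFn_mem_FP okT_mem_FP (iteFn_mem_FP (isD_mem_FP 0) V4_mem_FP (iteFn_mem_FP (isD_mem_FP 4) Vm4_mem_FP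
    (iteFn_mem_FP (isD_mem_FP 1) V3_mem_FP (iteFn_mem_FP (isD_mem_FP 7) V3_mem_FP
      (iteFn_mem_FP (isD_mem_FP 3) Vm3_mem_FP (iteFn_mem_FP (isD_mem_FP 5) Vm3_mem_FP V0_mem_FP)))))) V0_mem_FP

/-! #### Boolean models of the tests, on every string -/

/-- The Boolean model of `c0T`, on every string. [folklore] -/
theorem c0T_apply (t : List Bool) : c0T t = [headBit (co2F t)] := bitT_apply _ _
/-- The Boolean model of `c1T`, on every string. [folklore] -/
theorem c1T_apply (t : List Bool) : c1T t = [headBit (co2F t).tail] := bitT_apply _ _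
/-- The Boolean model of `c2T`, on every string. [folklore] -/
theorem c2T_apply (t : List Bool) : c2T t = [headBit (co2F t).tail.tail] := bitT_apply _ _
/-- The Boolean model of `sgT`, on every string. [folklore] -/
theorem sgT_apply (t : List Bool) : sgT t = [headBit (w1F t)] := bitT_apply _ _

/-- The Boolean model of `okT`. [folklore] -/
def okB (t : List Bool) : Bool :=
  decide (v1F t = [true]) && (decide (v2F t = [true]) && decide (w1F t = w2F t))

/-- The Boolean model of `okT`, on every string. [folklore] -/
theorem okT_apply (t : List Bool) : okT t = [okB t] := by
  rw [okT, okB, andFn_apply (eqC_apply _ _ t) (andFn_apply (eqC_apply _ _ t)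
    (show (eqPairFn ∘ pr w1F w2F) t = [decide (w1F t = w2F t)] by simp [eqPairFn_boolPair]))]

/-- The Boolean model of `isD`, on every string. [folklore] -/
theorem isD_apply (k : ℕ) (t : List Bool) : isD k t = [decide (diffF t = ones k)] := eqC_apply _ _ _

/-- The Boolean model of `all3`, on every string. [folklore] -/
theorem all3_apply (t : List Bool) :
    all3 t = [headBit (co2F t) && (headBit (co2F t).tail && headBit (co2F t).tail.tail)] := by
  rw [all3, andFn_apply (c0T_apply t) (andFn_apply (c1T_apply t) (c2T_apply t))]

/-- The Boolean model of `none3`, on every string. [folklore] -/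
theorem none3_apply (t : List Bool) :
    none3 t = [!headBit (co2F t) && (!headBit (co2F t).tail && !headBit (co2F t).tail.tail)] := by
  rw [none3, andFn_apply (notFn_apply (c0T_apply t)) (andFn_apply (notFn_apply (c1T_apply t))
    (notFn_apply (c2T_apply t)))]

/-- The verdict tree on Boolean data: validity `ok`, sign `s`, the class tests
`e0 e4 e1 e7 e3 e5`, the three coins. [folklore] -/
def vtree (ok s e0 e4 e1 e7 e3 e5 c₀ c₁ c₂ : Bool) : Bool :=
  if ok then
    if e0 then (if s then true else false) else
    if e4 then (if s then false else true) else
    if e1 then (if s then !(c₀ && (c₁ && c₂)) else (!c₀ && (!c₁ && !c₂))) else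
    if e7 then (if s then !(c₀ && (c₁ && c₂)) else (!c₀ && (!c₁ && !c₂))) else
    if e3 then (if s then (!c₀ && (!c₁ && !c₂)) else !(c₀ && (c₁ && c₂))) else
    if e5 then (if s then (!c₀ && (!c₁ && !c₂)) else !(c₀ && (c₁ && c₂))) else
    !c₂
  else !c₂

/-- `verdictF` is the verdict tree on the Boolean models of its tests, on every string. [folklore] -/
theorem verdictF_apply (t : List Bool) :
    verdictF t = [vtree (okB t) (headBit (w1F t)) (decide (diffF t = ones 0)) (decide (diffF t = ones 4))
      (decide (diffF t = ones 1)) (decide (diffF t = ones 7)) (decide (diffF t = ones 3))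
      (decide (diffF t = ones 5)) (headBit (co2F t)) (headBit (co2F t).tail) (headBit (co2F t).tail.tail)] := by
  simp only [verdictF, V4, Vm4, V3, Vm3, V0, iteFn_apply (okT_apply t), iteFn_apply (isD_apply _ t),
    iteFn_apply (sgT_apply t), notFn_apply (all3_apply t), notFn_apply (c2T_apply t), none3_apply]
  unfold vtree
  split_ifs <;> rfl

/-- `verdictF` is one-bit. [folklore] -/
theorem oneBit_verdictF : OneBit verdictF := fun t => ⟨_, verdictF_apply t⟩

/-- **The verdict tree is the threshold test** `⟦c⟧ < 4 + wt` with
`wt = sign · wt8 D` on nontrivial guesses and `wt = 0` on trivial ones.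
[cite: AdlemanDeMarraisHuang1997, §6 Lemma 6.10 (proof, steps 4–5 and the count "abs(a_{P₁,0} a_{P₂,0}) sets of pairs G₁, G₂ for each value of E")] -/
theorem vtree_eq_threshold (ok s : Bool) (D : ℕ) (hD : D < 8) (c₀ c₁ c₂ : Bool) :
    vtree ok s (decide (D = 0)) (decide (D = 4)) (decide (D = 1)) (decide (D = 7)) (decide (D = 3))
      (decide (D = 5)) c₀ c₁ c₂ =
      threshold (4 + if ok then (if s then 1 else -1) * wt8 D else 0) [c₀, c₁, c₂] := by
  interval_cases D <;> revert ok s c₀ c₁ c₂ <;> decide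

end Verdict

/-! ### The predicate `adhFn` -/

section AdhFn

variable (F : QCircuitFamily cliffordT)

/-- **The ADH predicate** on `⟨x, y⟩`: both walks, then the verdict.
[cite: AdlemanDeMarraisHuang1997, §6 Lemma 6.10 (proof: the machine M')] -/
def adhFn : List Bool → List Bool := verdictF ∘ twoF F

/-- **`adhFn F ∈ FP`** for a uniform family. [cite: AdlemanDeMarraisHuang1997, §6 Lemma 6.10 (proof: M' runs in polynomial time)] -/
theorem adhFn_mem_FP (hU : F.IsUniform) : adhFn F ∈ FP := comp_mem_FP verdictF_mem_FP (twoF_mem_FP F hU)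

/-- `adhFn F` is one-bit. [folklore] -/
theorem oneBit_adhFn : OneBit (adhFn F) := oneBit_verdictF.comp _

/-- The acceptance sign as the first bit of the label. [folklore] -/
theorem accSign_eq_headBit {M : ℕ} (z : QReg M) : accSign z = if headBit (List.ofFn z) then 1 else -1 := by
  unfold accSign
  cases M with
  | zero => simp
  | succ M => simp [List.ofFn_succ, headBit]

/-- Equality of phase registers is equality of phases. [folklore] -/
theorem ones_inj {a b : ℕ} : ones a = ones b ↔ a = b :=
  ⟨fun h => by simpa [ones] using congrArg List.length h, fun h => h ▸ rfl⟩

/-- The class register on a pair of walk records. [folklore] -/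
theorem diffF_pair (d₁ E₁ co₁ wl₁ v₁ d₂ E₂ co₂ wl₂ v₂ : List Bool) (φ₁ φ₂ : ℕ) :
    diffF (boolPair (rec6 d₁ E₁ co₁ wl₁ (ones φ₁) v₁) (rec6 d₂ E₂ co₂ wl₂ (ones φ₂) v₂)) =
      ones ((φ₁ + 7 * φ₂) % 8) := by
  simp only [diffF, rep7, Function.comp_apply, fanoutFn_apply, OracleCompose.concatFn_boolPair, modLenFn_boolPair,
    fstF_boolPair, sndF_boolPair, rec6, nthF, List.length_append, length_ones]
  congr 1
  omega

variable (hF : F.IsOracleFree) (x y : List Bool)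
include hF

/-- **Value of the ADH predicate.** On `⟨x, b b' c u⟩` (`|b| = |b'| =` the number `μ` of gates of
the `|x|`-th circuit, `|c| = 3`, `u` arbitrary) the predicate answers "yes" iff
`⟦c⟧ < 4 + wtPair(b, b')`. [cite: AdlemanDeMarraisHuang1997, §6 Lemma 6.10 (proof, steps 3–5)] -/
theorem adhFn_boolPair (hy : 2 * (F.circ x.length).gates.length + 3 ≤ y.length) :
    adhFn F (boolPair x y) =
      (let μ := (F.circ x.length).gates.length
       [threshold (4 + wtPair (F.circ x.length).gates (w₀ F x) (y.take μ) ((y.drop μ).take μ))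
         ((y.drop (2 * μ)).take 3)]) := by
  have htwo := twoF_boolPair F x y hF
  have hwt := wtPair_eq_of_tRun (F.circ x.length).gates (w₀ F x) y (y.drop (F.circ x.length).gates.length)
    (by omega) (by simp only [List.length_drop]; omega)
  simp only at htwo hwt ⊢
  rw [hwt]
  set gs := (F.circ x.length).gates with hgs
  set μ := gs.length with hμ
  obtain ⟨⟨z₁, φ₁, v₁⟩, hr⟩ : ∃ s, tRun gs y (w₀ F x, 0, true) = s := ⟨_, rfl⟩
  obtain ⟨⟨z₂, φ₂, v₂⟩, hr'⟩ : ∃ s, tRun gs (y.drop μ) (w₀ F x, 0, true) = s := ⟨_, rfl⟩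
  rw [hr, hr'] at htwo
  simp only [hr, hr']
  -- the three coins
  obtain ⟨c₀, c₁, c₂, u, hu⟩ : ∃ c₀ c₁ c₂ u, (y.drop μ).drop μ = c₀ :: c₁ :: c₂ :: u := by
    have hl : 3 ≤ ((y.drop μ).drop μ).length := by simp only [List.length_drop]; omega
    rcases h : (y.drop μ).drop μ with _ | ⟨c₀, _ | ⟨c₁, _ | ⟨c₂, u⟩⟩⟩ <;>
      simp only [h, List.length_cons, List.length_nil] at hl
    · omega
    · omega
    · omega
    · exact ⟨c₀, c₁, c₂, u, rfl⟩
  have hc : (y.drop (2 * μ)).take 3 = [c₀, c₁, c₂] := by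
    rw [two_mul, ← List.drop_drop, hu]; rfl
  rw [hc]
  show verdictF (twoF F (boolPair x y)) = _
  rw [htwo, verdictF_apply, diffF_pair]
  simp only [okB, Function.comp_apply, fstF_boolPair, sndF_boolPair, rec6, nthF, sndPow, hu, List.tail_cons,
    headBit_cons, List.ofFn_inj, ones_inj, List.cons.injEq, and_true, Bool.decide_eq_true]
  rw [vtree_eq_threshold _ _ _ (Nat.mod_lt _ (by norm_num)), accSign_eq_headBit]
  cases v₁ <;> cases v₂ <;> by_cases h : z₁ = z₂ <;> simp [h]

end AdhFn

end ADH

end Literature.Computability.QuantumComplexity
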